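import Summits.HodgeConjecture.HodgeConjecture.Theorems.ThreefoldSquareKunnethShifts
import Literature.AlgebraicGeometry.HodgeTheory.LefschetzStandardUnconditionalDegrees
import Literature.AlgebraicGeometry.HodgeTheory.ComplexOrientationFamily
import Literature.AlgebraicTopology.SingularHomology.CupProductProofs
import Literature.AlgebraicGeometry.HodgeTheory.SmoothHyperplaneSectionClassLine
import HarnessLib

/-!
# The weight-one curve retractions `W1Retr[X]` of a smooth projective threefold from ONE smooth curve of class `σ²`
# (cell `hodge-nonav`, sector SQ3, row SQ3-W input; target T3 / A20-c)

PROVENANCE. Cell hodge-nonav (HUMAN RULING D-0038), planner p1 (memo `HOME/memos/ROUTE-P1T.md` §6 A20-c; assignment T3, STATUS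
2026-08-28T05:21:56Z), prover seat `hodge-nonav-20241-p1` (g10). SUPPORT FILE (`--supports stmt-HodgeConjecture-19654 --as helper`).

THE POINT. The typed input `W1Retr[X]` of the odd Künneth slots of the square of a threefold (`oddShifts_algebraic_of_hc22TimesCurve`,
file `Theorems/ThreefoldSquareKunnethShifts`) asks for a smooth projective curve `C` and correspondences `u : H⁵(X) → H¹(C)`
(algebraic) with a rational-Hodge retraction `v`, and `v' : H¹(C) → H¹(X)` (algebraic) with a rational-Hodge section `u'`. The
planner's memo expected the classical assembly (Albanese curve, Poincaré complete reducibility, Lefschetz `(1,1)`). Here it is proved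
WITHOUT Poincaré reducibility, from a single smooth curve `j : C ⟶ X` whose class `j_* 1_C ∈ H⁴(X)` is `σ ∪ σ` for a polarisation
class `σ` of `X` (a smooth complete intersection of two members of `|σ|` — Bertini; this existence is the only remaining input and is
kept as the hypothesis): by the projection formula `j_* j^* x = x ∪ j_* 1 = x ∪ σ² = L_σ² x` on `H¹(X)`, and `L_σ² : H¹ ≅ H⁵` is
inverted by André's `Λ = ⋆_L : H⁵ → H¹`, which is ALGEBRAIC unconditionally (`isAlgebraicCorrespondence_lefschetzInvolution_to_one`,
Lefschetz `(1,1)` on `X × X`). Hence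

  `u := j^* ∘ Λ`, `v := j_*` (so `v ∘ u = L² ∘ Λ = id`),  `v' := Λ ∘ j_*`, `u' := j^*` (so `v' ∘ u' = Λ ∘ L² = id`),

all four algebraic (pull-backs, Gysin maps, `⋆_L → H¹`, compositions), in particular rational Hodge shifts.

CONTENT: `gysin_map_eq_lefschetzPow_two_of_class` (`j_* j^* = L_σ²` on `H¹(X)`), `w1Retr_of_curve_of_class_sq` (the retractions), and
the corollary `oddShifts_algebraic_of_curve_of_hc22TimesCurve` (the odd slots from such a curve + `HC22C[X]`). DEF-FREE; the sketches'
Prop-abbreviations are file-local notation as in part 1. HONEST SCOPE: structure theorem; the curve of class `σ²` is a hypothesis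
(PRINT: Bertini); nothing here proves HC for a new variety; rung F-H1 not moved.

## References

* [VoisinHodgeI2002] C. Voisin, Hodge Theory and Complex Algebraic Geometry I (2002), §7.3.2 (Gysin, projection formula), Thm. 6.25.
* [FultonYoungTableaux1997] W. Fulton, Young Tableaux (1997), App. B §B.1 (5)–(6).
* [Andre1996Motifs] Y. André, Pour une théorie inconditionnelle des motifs (1996), §1.1 (`⋆_L`), §2.1.
* [Kleiman1968AlgebraicCycles] S. Kleiman, Algebraic cycles and the Weil conjectures (1968), §2 (2A11).
-/

set_option linter.dupNamespace false

noncomputable section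

open CategoryTheory AlgebraicGeometry MonoidalCategory CartesianMonoidalCategory
open Literature.AlgebraicTopology.SingularHomology
open Literature.AlgebraicGeometry Literature.AlgebraicGeometry.Motives Literature.AlgebraicGeometry.HodgeTheory
open Literature.Geometry.Kaehler
open Summit.HodgeConjecture.HodgeConjecture.Theorems
open Summit.HodgeConjecture.HodgeConjecture.Ring2.AbelianAll

namespace Summit.HodgeConjecture.HodgeConjecture.Theorems.ThreefoldSquare

/-- `RHShift[m, n, Y, X, a, b, e, φ]` (as in `Theorems/ThreefoldSquareKunnethShifts`). Local notation only. -/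
local notation3 (prettyPrint := false) "RHShift[" m ", " n ", " Y ", " X ", " a ", " b ", " e ", " φ "]" =>
  ((∀ c, IsRationalClass c → IsRationalClass (φ c)) ∧
  (∀ (p q : ℕ), p + q = a → ∀ c, IsOfHodgeType n X a p q c →
      ∀ (p' q' : ℕ), p' + n = p + e → q' + n = q + e → IsOfHodgeType m Y b p' q' (φ c)) ∧
  (∀ (p q : ℕ), p + q = a → ∀ c, IsOfHodgeType n X a p q c → (p + e < n ∨ q + e < n) → φ c = 0))

/-- `OddShifts[X]` (as in `Theorems/ThreefoldSquareKunnethShifts`). Local notation only. -/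
local notation3 (prettyPrint := false) "OddShifts[" X "]" =>
  ((∀ φ : complexBetti X 5 →ₗ[ℂ] complexBetti X 3,
    RHShift[3, 3, X, X, 5, 3, 2, φ] → IsAlgebraicCorrespondence 3 3 X X φ) ∧
  (∀ φ : complexBetti X 3 →ₗ[ℂ] complexBetti X 1,
    RHShift[3, 3, X, X, 3, 1, 2, φ] → IsAlgebraicCorrespondence 3 3 X X φ))

/-- `W1Retr[X]` (as in `Theorems/ThreefoldSquareKunnethShifts`). Local notation only. -/
local notation3 (prettyPrint := false) "W1Retr[" X "]" =>
  (∃ (C : SchemeOver ℂ) (_ : IsSmoothProjective 1 C)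
    (u : complexBetti X 5 →ₗ[ℂ] complexBetti C 1) (v : complexBetti C 1 →ₗ[ℂ] complexBetti X 5)
    (u' : complexBetti X 1 →ₗ[ℂ] complexBetti C 1) (v' : complexBetti C 1 →ₗ[ℂ] complexBetti X 1),
    IsAlgebraicCorrespondence 1 3 C X u ∧ RHShift[3, 1, X, C, 1, 5, 3, v] ∧ v ∘ₗ u = LinearMap.id ∧
    IsAlgebraicCorrespondence 3 1 X C v' ∧ RHShift[1, 3, C, X, 1, 1, 3, u'] ∧ v' ∘ₗ u' = LinearMap.id)

/-- `HC22C[X]` (as in `Theorems/ThreefoldSquareKunnethShifts`; = body of `ThreefoldTimesCurve.HC22TimesCurve X`). Local notation only. -/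
local notation3 (prettyPrint := false) "HC22C[" X "]" =>
  (∀ ⦃C : SchemeOver ℂ⦄, IsSmoothProjective 1 C →
    (∀ c : complexBetti (X ⊗ C) (2 * 2), IsRationalClass c →
        IsOfHodgeType (3 + 1) (X ⊗ C) (2 * 2) 2 2 c → c ∈ algebraicClasses (X ⊗ C) 2) ∧
      (∀ c : complexBetti (C ⊗ X) (2 * 2), IsRationalClass c →
        IsOfHodgeType (1 + 3) (C ⊗ X) (2 * 2) 2 2 c → c ∈ algebraicClasses (C ⊗ X) 2))

variable {X C : SchemeOver ℂ}

/-- **`j_* j^* = L_σ²` on `H¹(X)` for a curve of class `σ²`**: if `j : C ⟶ X` is a morphism from a smooth projective curve into the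
smooth projective threefold `X` with `j_* 1_C = σ ∪ σ`, then `j_*(j^* x) = σ ∪ (σ ∪ x)` for `x ∈ H¹(X)` (projection formula
`j_*(j^* x ∪ 1) = x ∪ j_* 1`, graded commutativity in degrees `1, 4`, associativity). [cite: FultonYoungTableaux1997, Appendix B §B.1 (6)]
[cite: HatcherAT2002, §3.2 Thm. 3.11] -/
theorem gysin_map_eq_lefschetzPow_two_of_class (hX : IsSmoothProjective 3 X) (hC : IsSmoothProjective 1 C)
    (j : C ⟶ X) {σ : complexBetti X 2}
    (hcls : complexGysin complexOrientationFamily hC hX j (rfl : 0 + 2 * 3 = 4 + 2 * 1)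
        (singularCohomology.one ℂ (ComplexPoints C)) = cupProduct (rfl : 2 + 2 = 4) σ σ)
    (x : complexBetti X 1) :
    complexGysin complexOrientationFamily hC hX j (rfl : 1 + 2 * 3 = (1 + 2 * 2) + 2 * 1)
        ((complexBetti.map j 1).hom x) = lefschetzPow σ 2 1 x := by
  have hμ := hasPoincareDuality_complexOrientationFamily
  -- projection formula
  have h := complexGysin_cup hμ hC hX j (p := 1) (q := 0) (a := 1) (b := 1 + 2 * 2) (q' := 4)
    (Nat.add_zero 1) rfl rfl rfl x (singularCohomology.one ℂ (ComplexPoints C))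
  rw [cupProduct_one] at h
  change complexGysin complexOrientationFamily hC hX j _ (complexBetti.map j 1 x) = _
  rw [h, hcls]
  -- `x ∪ (σ ∪ σ) = (σ ∪ σ) ∪ x = σ ∪ (σ ∪ x)`
  rw [cupProduct_gradedComm_holds ℂ (ComplexPoints X) (rfl : 1 + 4 = 1 + 2 * 2) (rfl : 4 + 1 = 1 + 2 * 2) x
      (cupProduct (rfl : 2 + 2 = 4) σ σ)]
  rw [show ((-1 : ℂ) ^ (1 * 4)) = 1 by norm_num, one_smul]
  rw [cupProduct_assoc (rfl : 2 + 2 = 4) (rfl : 2 + 1 = 1 + 2 * 1) (rfl : 4 + 1 = 1 + 2 * 2)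
      (rfl : 2 + (1 + 2 * 1) = 1 + 2 * 2)]
  simp only [lefschetzPow_succ, lefschetzPow_zero, LinearMap.comp_apply, LinearMap.id_apply, lefschetzOperator_apply]

/-- **`W1Retr[X]` from one smooth curve of class `σ²`.** For a smooth projective threefold `X`, a polarisation class `σ` and a
morphism `j : C ⟶ X` from a smooth projective curve with `j_* 1_C = σ ∪ σ` (a smooth complete intersection of two members of `|σ|`):
`u := j^* ∘ ⋆_L : H⁵(X) → H¹(C)` and `v' := ⋆_L ∘ j_* : H¹(C) → H¹(X)` are algebraic (Gysin / pull-back / `⋆_L : H⁵ → H¹` is algebraic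
unconditionally, `isAlgebraicCorrespondence_lefschetzInvolution_to_one`), `v := j_*` and `u' := j^*` are algebraic hence rational
Hodge shifts, and `v ∘ u = L² ⋆ = id`, `v' ∘ u' = ⋆ L² = id` by `gysin_map_eq_lefschetzPow_two_of_class` and hard Lefschetz. No
Poincaré reducibility is used. (statement: cell hodge-nonav ROUTE-P1T §6 A20-c; assembly not in print in this form)
[cite: Andre1996Motifs, §1.1 (p. 10) and §2.1] [cite: Kleiman1968AlgebraicCycles, §2 2A11] [cite: VoisinHodgeI2002, Thm. 6.25 and §7.3.2] -/
theorem w1Retr_of_curve_of_class_sq (hX : IsSmoothProjective 3 X) (hC : IsSmoothProjective 1 C)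
    (j : C ⟶ X) {σ : complexBetti X 2} (hσ : IsPolarizationClass 3 X σ)
    (hcls : complexGysin complexOrientationFamily hC hX j (rfl : 0 + 2 * 3 = 4 + 2 * 1)
        (singularCohomology.one ℂ (ComplexPoints C)) = cupProduct (rfl : 2 + 2 = 4) σ σ) :
    W1Retr[X] := by
  have hμ := hasPoincareDuality_complexOrientationFamily
  have hL := hσ.hasHardLefschetz
  -- the four maps
  set gy : complexBetti C 1 →ₗ[ℂ] complexBetti X (1 + 2 * 2) :=
    complexGysin complexOrientationFamily hC hX j (rfl : 1 + 2 * 3 = (1 + 2 * 2) + 2 * 1) with hgy_def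
  set pb : complexBetti X 1 →ₗ[ℂ] complexBetti C 1 := (complexBetti.map j 1).hom with hpb_def
  set Λ : complexBetti X (1 + 2 * 2) →ₗ[ℂ] complexBetti X 1 :=
    lefschetzInvolution hL (show 1 + 2 * 2 + 1 = 2 * 3 by norm_num) with hΛ_def
  -- `j_* j^* = L²`, hence `Λ j_* j^* = id` and `j_* j^* Λ = id`
  have hL2 : ∀ x : complexBetti X 1, gy (pb x) = lefschetzPow σ 2 1 x :=
    fun x ↦ gysin_map_eq_lefschetzPow_two_of_class hX hC j hcls x
  have h₁ : ∀ x : complexBetti X 1, Λ (gy (pb x)) = x := fun x ↦ by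
    rw [hL2 x]
    exact lefschetzInvolution_lefschetzPow hL (b := 1) (j := 2) (by norm_num) _ x
  have h₂ : ∀ y : complexBetti X (1 + 2 * 2), gy (pb (Λ y)) = y := fun y ↦ by
    rw [hL2]
    exact lefschetzPow_lefschetzInvolution hL (b := 1) (j := 2) (by norm_num) _ y
  -- algebraicity of the pieces
  have hgyA : IsAlgebraicCorrespondence 3 1 X C gy :=
    isAlgebraicCorrespondence_complexGysin complexOrientationFamily hμ hC hX j _ (q := 1) (by norm_num)
  have hpbA : IsAlgebraicCorrespondence 1 3 C X pb := isAlgebraicCorrespondence_map hC hX j (by norm_num)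
  have hΛA : IsAlgebraicCorrespondence 3 3 X X Λ :=
    isAlgebraicCorrespondence_lefschetzInvolution_to_one hX hσ _ rfl
  -- rational Hodge shifts
  have hgyS : RHShift[3, 1, X, C, 1, 1 + 2 * 2, 3, gy] := rhShift_complexGysin hC hX j _ (by norm_num)
  have hpbS : RHShift[1, 3, C, X, 1, 1, 3, pb] := rhShift_map hC hX j 1
  refine ⟨C, hC, pb ∘ₗ Λ, gy, pb, Λ ∘ₗ gy, ?_, hgyS, ?_, ?_, hpbS, ?_⟩
  · exact IsAlgebraicCorrespondence.comp hC hX hX hΛA hpbA (by norm_num)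
  · exact LinearMap.ext fun y ↦ by simpa only [LinearMap.comp_apply, LinearMap.id_apply] using h₂ y
  · exact IsAlgebraicCorrespondence.comp hX hX hC hgyA hΛA (by norm_num)
  · exact LinearMap.ext fun x ↦ by simpa only [LinearMap.comp_apply, LinearMap.id_apply] using h₁ x

/-- **Corollary: the odd Künneth slots of `HC22sq(X)` from one smooth curve of class `σ²` and the fourfold input `HC22C[X]`**
(`oddShifts_algebraic_of_hc22TimesCurve` with `W1Retr[X]` discharged by `w1Retr_of_curve_of_class_sq`).
[cite: VoisinHodgeI2002, §11.3.3 Lemma 11.41] [cite: Kleiman1968AlgebraicCycles, §2 2A11] -/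
theorem oddShifts_algebraic_of_curve_of_hc22TimesCurve (hX : IsSmoothProjective 3 X) (hC : IsSmoothProjective 1 C)
    (j : C ⟶ X) {σ : complexBetti X 2} (hσ : IsPolarizationClass 3 X σ)
    (hcls : complexGysin complexOrientationFamily hC hX j (rfl : 0 + 2 * 3 = 4 + 2 * 1)
        (singularCohomology.one ℂ (ComplexPoints C)) = cupProduct (rfl : 2 + 2 = 4) σ σ)
    (h : HC22C[X]) : OddShifts[X] :=
  oddShifts_algebraic_of_hc22TimesCurve hX (w1Retr_of_curve_of_class_sq hX hC j hσ hcls) h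

/-! ## Appended 2026-08-28 (same seat, g10): the SCALAR-TWISTED form — a curve of class `c • σ²`, `c ≠ 0`

The tree's Bertini road (`SmoothHyperplaneSectionPolarization`: hard Lefschetz of a smooth hyperplane section's class `u_* 1` is
proved through "the hyperplane class lies in `ℂ · u_* 1`") delivers classes only UP TO A NON-ZERO SCALAR; the mechanism is
insensitive to it: if `j_* 1_C = c • (σ ∪ σ)` then `j_* j^* = c • L_σ²` on `H¹(X)` and `c⁻¹ • ⋆_L` inverts it on both sides, still
an algebraic correspondence (`IsAlgebraicCorrespondence.smul`). -/

/-- **`j_* j^* = c • L_σ²` on `H¹(X)` for a curve of class `c • σ²`.** [cite: FultonYoungTableaux1997, Appendix B §B.1 (6)]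
[cite: HatcherAT2002, §3.2 Thm. 3.11] -/
theorem gysin_map_eq_smul_lefschetzPow_two_of_class_smul (hX : IsSmoothProjective 3 X) (hC : IsSmoothProjective 1 C)
    (j : C ⟶ X) {σ : complexBetti X 2} {c : ℂ}
    (hcls : complexGysin complexOrientationFamily hC hX j (rfl : 0 + 2 * 3 = 4 + 2 * 1)
        (singularCohomology.one ℂ (ComplexPoints C)) = c • cupProduct (rfl : 2 + 2 = 4) σ σ)
    (x : complexBetti X 1) :
    complexGysin complexOrientationFamily hC hX j (rfl : 1 + 2 * 3 = (1 + 2 * 2) + 2 * 1)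
        ((complexBetti.map j 1).hom x) = c • lefschetzPow σ 2 1 x := by
  have hμ := hasPoincareDuality_complexOrientationFamily
  have h := complexGysin_cup hμ hC hX j (p := 1) (q := 0) (a := 1) (b := 1 + 2 * 2) (q' := 4)
    (Nat.add_zero 1) rfl rfl rfl x (singularCohomology.one ℂ (ComplexPoints C))
  rw [cupProduct_one] at h
  change complexGysin complexOrientationFamily hC hX j _ (complexBetti.map j 1 x) = _
  rw [h, hcls, map_smul]
  congr 1
  rw [cupProduct_gradedComm_holds ℂ (ComplexPoints X) (rfl : 1 + 4 = 1 + 2 * 2) (rfl : 4 + 1 = 1 + 2 * 2) x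
      (cupProduct (rfl : 2 + 2 = 4) σ σ)]
  rw [show ((-1 : ℂ) ^ (1 * 4)) = 1 by norm_num, one_smul]
  rw [cupProduct_assoc (rfl : 2 + 2 = 4) (rfl : 2 + 1 = 1 + 2 * 1) (rfl : 4 + 1 = 1 + 2 * 2)
      (rfl : 2 + (1 + 2 * 1) = 1 + 2 * 2)]
  simp only [lefschetzPow_succ, lefschetzPow_zero, LinearMap.comp_apply, LinearMap.id_apply, lefschetzOperator_apply]

/-- **`W1Retr[X]` from one smooth curve of class `c • σ²`, `c ≠ 0`** (the form in which a Bertini-type existence theorem, with its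
scalar ambiguity, plugs in): `u := j^* ∘ (c⁻¹ • ⋆_L)`, `v := j_*`, `v' := (c⁻¹ • ⋆_L) ∘ j_*`, `u' := j^*`. No Poincaré reducibility.
(statement: cell hodge-nonav ROUTE-P1T §6 A20-c, scalar-twisted; assembly not in print in this form)
[cite: Andre1996Motifs, §1.1 (p. 10) and §2.1] [cite: Kleiman1968AlgebraicCycles, §2 2A11] [cite: VoisinHodgeI2002, Thm. 6.25 and §7.3.2] -/
theorem w1Retr_of_curve_of_class_smul_sq (hX : IsSmoothProjective 3 X) (hC : IsSmoothProjective 1 C)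
    (j : C ⟶ X) {σ : complexBetti X 2} (hσ : IsPolarizationClass 3 X σ) {c : ℂ} (hc : c ≠ 0)
    (hcls : complexGysin complexOrientationFamily hC hX j (rfl : 0 + 2 * 3 = 4 + 2 * 1)
        (singularCohomology.one ℂ (ComplexPoints C)) = c • cupProduct (rfl : 2 + 2 = 4) σ σ) :
    W1Retr[X] := by
  have hμ := hasPoincareDuality_complexOrientationFamily
  have hL := hσ.hasHardLefschetz
  set gy : complexBetti C 1 →ₗ[ℂ] complexBetti X (1 + 2 * 2) :=
    complexGysin complexOrientationFamily hC hX j (rfl : 1 + 2 * 3 = (1 + 2 * 2) + 2 * 1) with hgy_def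
  set pb : complexBetti X 1 →ₗ[ℂ] complexBetti C 1 := (complexBetti.map j 1).hom with hpb_def
  set Λ : complexBetti X (1 + 2 * 2) →ₗ[ℂ] complexBetti X 1 :=
    c⁻¹ • lefschetzInvolution hL (show 1 + 2 * 2 + 1 = 2 * 3 by norm_num) with hΛ_def
  have hL2 : ∀ x : complexBetti X 1, gy (pb x) = c • lefschetzPow σ 2 1 x :=
    fun x ↦ gysin_map_eq_smul_lefschetzPow_two_of_class_smul hX hC j hcls x
  have h₁ : ∀ x : complexBetti X 1, Λ (gy (pb x)) = x := fun x ↦ by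
    rw [hL2 x, hΛ_def, LinearMap.smul_apply, map_smul, smul_smul, inv_mul_cancel₀ hc, one_smul]
    exact lefschetzInvolution_lefschetzPow hL (b := 1) (j := 2) (by norm_num) _ x
  have h₂ : ∀ y : complexBetti X (1 + 2 * 2), gy (pb (Λ y)) = y := fun y ↦ by
    rw [hL2, hΛ_def, LinearMap.smul_apply, map_smul, smul_smul, mul_inv_cancel₀ hc, one_smul]
    exact lefschetzPow_lefschetzInvolution hL (b := 1) (j := 2) (by norm_num) _ y
  have hgyA : IsAlgebraicCorrespondence 3 1 X C gy :=
    isAlgebraicCorrespondence_complexGysin complexOrientationFamily hμ hC hX j _ (q := 1) (by norm_num)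
  have hpbA : IsAlgebraicCorrespondence 1 3 C X pb := isAlgebraicCorrespondence_map hC hX j (by norm_num)
  have hΛA : IsAlgebraicCorrespondence 3 3 X X Λ :=
    IsAlgebraicCorrespondence.smul hX hX
      (isAlgebraicCorrespondence_lefschetzInvolution_to_one hX hσ (show 1 + 2 * 2 + 1 = 2 * 3 by norm_num) rfl) c⁻¹
  have hgyS : RHShift[3, 1, X, C, 1, 1 + 2 * 2, 3, gy] := rhShift_complexGysin hC hX j _ (by norm_num)
  have hpbS : RHShift[1, 3, C, X, 1, 1, 3, pb] := rhShift_map hC hX j 1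
  refine ⟨C, hC, pb ∘ₗ Λ, gy, pb, Λ ∘ₗ gy, ?_, hgyS, ?_, ?_, hpbS, ?_⟩
  · exact IsAlgebraicCorrespondence.comp hC hX hX hΛA hpbA (by norm_num)
  · exact LinearMap.ext fun y ↦ by simpa only [LinearMap.comp_apply, LinearMap.id_apply] using h₂ y
  · exact IsAlgebraicCorrespondence.comp hX hX hC hgyA hΛA (by norm_num)
  · exact LinearMap.ext fun x ↦ by simpa only [LinearMap.comp_apply, LinearMap.id_apply] using h₁ x

/-! ## Appended 2026-08-28 (same seat, g11): `W1Retr[X]` for EVERY smooth projective threefold, modulo the tree's Bertini fact only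

The «smooth curve of class `c • σ²`, `c ≠ 0`» is now a theorem of the Literature layer
(`HodgeTheory/SmoothHyperplaneSectionClassLine`: `exists_curve_complexGysin_one_eq_smul_sq` — two smooth hyperplane sections in ONE
projective embedding; the class of a smooth hyperplane section spans `e^* H²(ℙᴺ)`, Gysin functoriality and the projection formula),
granted the named classical fact `Hartshorne1977_bertini_smoothHyperplaneSections`. Hence the weight-one curve retractions hold for every
smooth projective threefold modulo that single fact, and the odd Künneth slots of `HC22sq(X)` follow from the fourfold input `HC22C[X]`
alone. Nothing here proves HC for a new variety; rung F-H1 not moved. -/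

/-- **`W1Retr[X]` for every smooth projective complex threefold, granted Bertini**: combine the Literature existence theorem
`exists_curve_complexGysin_one_eq_smul_sq` (a smooth curve `j : C ⟶ X` and a polarisation class `σ` with `j_* 1_C = c • (σ ∪ σ)`,
`c ≠ 0`) with `w1Retr_of_curve_of_class_smul_sq`. No Poincaré reducibility, no Abel–Jacobi. (statement: cell hodge-nonav ROUTE-P1T
§6 A20-c; assembly not in print in this form) [cite: Hartshorne1977, II Thm. 8.18 and III Cor. 7.9]
[cite: FultonYoungTableaux1997, Appendix B §B.1 (5), (6) and §B.3] [cite: Andre1996Motifs, §1.1 (p. 10) and §2.1] -/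
theorem w1Retr_of_bertini (hBert : Hartshorne1977_bertini_smoothHyperplaneSections) (hX : IsSmoothProjective 3 X) :
    W1Retr[X] := by
  obtain ⟨C, hC, j, σ, -, hσ, c, hc, hcls⟩ := exists_curve_complexGysin_one_eq_smul_sq hBert hX
  exact w1Retr_of_curve_of_class_smul_sq hX hC j hσ hc hcls

/-- **Corollary: the odd Künneth slots of `HC22sq(X)` from the fourfold input `HC22C[X]` alone, granted Bertini**
(`oddShifts_algebraic_of_hc22TimesCurve` with `W1Retr[X]` discharged by `w1Retr_of_bertini`).
[cite: VoisinHodgeI2002, §11.3.3 Lemma 11.41] [cite: Kleiman1968AlgebraicCycles, §2 2A11] [cite: Hartshorne1977, II Thm. 8.18 and III Cor. 7.9] -/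
theorem oddShifts_algebraic_of_bertini_of_hc22TimesCurve (hBert : Hartshorne1977_bertini_smoothHyperplaneSections)
    (hX : IsSmoothProjective 3 X) (h : HC22C[X]) : OddShifts[X] :=
  oddShifts_algebraic_of_hc22TimesCurve hX (w1Retr_of_bertini hBert hX) h

end Summit.HodgeConjecture.HodgeConjecture.Theorems.ThreefoldSquare

end
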